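import Mathlib.RingTheory.MvPolynomial.Homogeneous
import Mathlib.RingTheory.MvPolynomial.Ideal
import Mathlib.Algebra.MvPolynomial.Monad
import Mathlib.Data.Fintype.Lattice
import Mathlib.Tactic.LinearCombination
import Mathlib.Tactic.Abel
import Mathlib.Tactic.Ring
import HarnessLib

/-!
# Crux `Steer` (stmt-ResolutionOfSingularities-16345), chain W4.1 — NRA bi-cone lemma, FILE 1: FORMS, VERTICES AND TRANSLATION RIGIDITY

OURS (campaign `res-hironaka`, rung L ★L-G4, slot W4.1; the bi-cone lemma `NonRationalWindow.BiCone` of res-L0-w41-strat-2's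
`NRA/BiCone_sketch.lean` 69f5142878e5aabd / route `NRA/BiCone-PROOF-ROUTE.md` 7e57beb60ac2f3f0 §2; seat res-D-pv-053 g9 on res-L0-w41-plan-1
RULING 286 (d)). Candidates, not facts; nothing here is a statement of H. Hironakaʼs manuscript [Hironaka2017] (status: under review). AI-written;
AI review is weaker than expert review. Definition-free, Mathlib-only commutative algebra.

## What is proved (`K` a field, `σ` any index type)
* `eval_smul_of_isHomogeneous` — a form of degree `n` is pointwise homogeneous: `φ(c·x) = cⁿ φ(x)`.
* `isHomogeneous_of_mem_pow_idealOfVars` — `φ ∈ (X_i)_i^d` with `totalDegree φ ≤ d` ⇒ `φ` is a form of degree `d` («order ≥ d at the origin and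
  degree ≤ d»).
* `totalDegree_bind₁_translate_le` — `deg φ(X + p) ≤ deg φ`; `eval_bind₁_translate` — `(φ(X + p))(x) = φ(x + p)`; `vertex_of_translate` — if `φ(X + p)` is a form of degree `d` then `p` is a VERTEX of
  degree `d` of the function `x ↦ φ(x)`: `φ(p + c·y) = c^d φ(p + y)`.
* **`translate_invariant_of_two_vertices`** (RIGIDITY, `K` infinite) — a function with two vertices `p ≠ p′` of the same degree `d` is invariant
  under every translation along the line `K·(p′ − p)`: homogeneity scaling gives `f(x + c·w) = f(x + w)` for `c ≠ 0`, and two non-zero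
  parameters `e ∉ {0, −t}` give `f(z + t·w) = f(z)` — no Hasse derivatives needed.
* `translate_invariant_of_mem_span` — the invariance directions form a `K`-subspace.
[folklore]
-/

noncomputable section

-- `Summit.<S>.<S>.…` duplicates the summit name by design (single-problem summit).
set_option linter.dupNamespace false

open MvPolynomial

namespace Summit.ResolutionOfSingularities.ResolutionOfSingularities.Theorems.SwitchingDichotomy.NonRationalWindow.BiConeForms

variable {K : Type*} [Field K] {σ : Type*}

/-! ## §1 Forms: pointwise homogeneity, and «point-order ≥ d with degree ≤ d» -/

/-- A form of degree `n` is pointwise homogeneous of degree `n`: `φ(c·x) = cⁿ·φ(x)`. [folklore] -/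
theorem eval_smul_of_isHomogeneous {φ : MvPolynomial σ K} {n : ℕ} (hφ : φ.IsHomogeneous n) (c : K) (x : σ → K) :
    eval (c • x) φ = c ^ n * eval x φ := by
  classical
  rw [MvPolynomial.eval_eq, MvPolynomial.eval_eq, Finset.mul_sum]
  refine Finset.sum_congr rfl fun m hm => ?_
  have hdeg : m.degree = n := by
    have h := hφ (mem_support_iff.mp hm)
    simpa [Finsupp.weight, Finsupp.degree, Finsupp.linearCombination_apply, Finsupp.sum] using h
  have hsum : ∑ i ∈ m.support, m i = n := by rw [← hdeg]; rfl
  have hprod : (∏ i ∈ m.support, (c • x) i ^ m i) = c ^ n * ∏ i ∈ m.support, x i ^ m i := by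
    simp only [Pi.smul_apply, smul_eq_mul, mul_pow, Finset.prod_mul_distrib, Finset.prod_pow_eq_pow_sum, hsum]
  rw [hprod]
  ring

/-- **«order ≥ d at the origin and degree ≤ d ⇒ a form of degree d».** [folklore] -/
theorem isHomogeneous_of_mem_pow_idealOfVars {φ : MvPolynomial σ K} {d : ℕ} (h : φ ∈ idealOfVars σ K ^ d)
    (hdeg : φ.totalDegree ≤ d) : φ.IsHomogeneous d := by
  classical
  rw [mem_pow_idealOfVars_iff] at h
  intro m hm
  have hm' : m ∈ φ.support := mem_support_iff.mpr hm
  have h1 : d ≤ m.degree := h m hm'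
  have h2 : (m.sum fun _ e => e) ≤ φ.totalDegree := le_totalDegree hm'
  have h3 : m.degree = m.sum fun _ e => e := by simp [Finsupp.degree, Finsupp.sum]
  have h4 : Finsupp.weight (1 : σ → ℕ) m = m.degree := by
    simp [Finsupp.weight, Finsupp.degree, Finsupp.linearCombination_apply, Finsupp.sum]
  rw [h4]
  omega

/-- A translate has no larger total degree: `deg φ(X + p) ≤ deg φ`. [folklore] -/
theorem totalDegree_bind₁_translate_le (p : σ → K) (φ : MvPolynomial σ K) :
    (bind₁ (fun i => X i + C (p i)) φ).totalDegree ≤ φ.totalDegree := by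
  classical
  rw [φ.as_sum, map_sum]
  refine (totalDegree_finsetSum _ _).trans (Finset.sup_le fun m hm => ?_)
  rw [bind₁_monomial]
  refine (totalDegree_mul _ _).trans ?_
  rw [totalDegree_C, zero_add]
  refine (totalDegree_finsetProd _ _).trans ?_
  have h1 : ∀ i ∈ m.support, ((X i + C (p i) : MvPolynomial σ K) ^ m i).totalDegree ≤ m i := fun i _ =>
    (totalDegree_pow _ _).trans (by
      have : (X i + C (p i) : MvPolynomial σ K).totalDegree ≤ 1 :=
        (totalDegree_add _ _).trans (max_le (by rw [totalDegree_X]) (by rw [totalDegree_C]; exact Nat.zero_le _))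
      calc m i * (X i + C (p i) : MvPolynomial σ K).totalDegree ≤ m i * 1 := Nat.mul_le_mul_left _ this
        _ = m i := mul_one _)
  calc ∑ i ∈ m.support, ((X i + C (p i) : MvPolynomial σ K) ^ m i).totalDegree ≤ ∑ i ∈ m.support, m i := Finset.sum_le_sum h1
    _ ≤ (∑ m' ∈ φ.support, monomial m' (coeff m' φ)).totalDegree := by
        rw [← φ.as_sum]
        exact le_totalDegree hm

/-! ## §2 Translations and vertices -/

/-- Evaluating a translate: `(φ(X + p))(x) = φ(x + p)`. [folklore] -/
theorem eval_bind₁_translate (p x : σ → K) (φ : MvPolynomial σ K) :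
    eval x (bind₁ (fun i => X i + C (p i)) φ) = eval (x + p) φ := by
  have h : (fun i => eval₂Hom (RingHom.id K) x (X i + C (p i))) = x + p := by
    funext i
    simp [Pi.add_apply]
  rw [show eval x (bind₁ (fun i => X i + C (p i)) φ) = eval₂Hom (RingHom.id K) x (bind₁ (fun i => X i + C (p i)) φ) from rfl,
    eval₂Hom_bind₁, h]
  rfl

/-- **Vertex.** If the translate `φ(X + p)` is a form of degree `d`, then `p` is a vertex of degree `d` of `x ↦ φ(x)`: `φ(p + c·y) = c^d·φ(p + y)`.
[folklore] -/
theorem vertex_of_translate {φ : MvPolynomial σ K} {d : ℕ} {p : σ → K} (h : (bind₁ (fun i => X i + C (p i)) φ).IsHomogeneous d)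
    (c : K) (y : σ → K) : eval (p + c • y) φ = c ^ d * eval (p + y) φ := by
  have h1 := eval_smul_of_isHomogeneous h c y
  rw [eval_bind₁_translate, eval_bind₁_translate] at h1
  rwa [add_comm p, add_comm p]

/-! ## §3 Rigidity: two vertices force translation invariance along the joining line -/

/-- **Two vertices of the same degree, scaling step**: `f(x + c·(p′ − p)) = f(x + (p′ − p))` for every `c ≠ 0`. [folklore] -/
theorem translate_eq_of_two_vertices {f : (σ → K) → K} {d : ℕ} {p p' : σ → K}
    (hp : ∀ (c : K) (y : σ → K), f (p + c • y) = c ^ d * f (p + y))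
    (hp' : ∀ (c : K) (y : σ → K), f (p' + c • y) = c ^ d * f (p' + y))
    {c : K} (hc : c ≠ 0) (x : σ → K) : f (x + c • (p' - p)) = f (x + (p' - p)) := by
  have e1 : x + c • (p' - p) = p + c • (c⁻¹ • (x - p) + (p' - p)) := by
    rw [smul_add, smul_smul, mul_inv_cancel₀ hc, one_smul]; abel
  have e2 : p + (c⁻¹ • (x - p) + (p' - p)) = p' + c⁻¹ • (x - p) := by abel
  have e3 : p' + (x - p) = x + (p' - p) := by abel
  rw [e1, hp, e2, hp' c⁻¹ (x - p), e3, ← mul_assoc, ← mul_pow, mul_inv_cancel₀ hc, one_pow, one_mul]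

/-- **RIGIDITY.** Over an infinite field, a function with two vertices `p`, `p′` of the same degree is invariant under every translation along
`K·(p′ − p)`. [folklore] -/
theorem translate_invariant_of_two_vertices [Infinite K] {f : (σ → K) → K} {d : ℕ} {p p' : σ → K}
    (hp : ∀ (c : K) (y : σ → K), f (p + c • y) = c ^ d * f (p + y))
    (hp' : ∀ (c : K) (y : σ → K), f (p' + c • y) = c ^ d * f (p' + y))
    (t : K) (z : σ → K) : f (z + t • (p' - p)) = f z := by
  classical
  obtain ⟨e, he⟩ := Infinite.exists_notMem_finset ({0, -t} : Finset K)
  simp only [Finset.mem_insert, Finset.mem_singleton, not_or] at he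
  obtain ⟨he0, het⟩ := he
  have hte : t + e ≠ 0 := fun h => het (by linear_combination h)
  have h1 := translate_eq_of_two_vertices hp hp' hte (z - e • (p' - p))
  have h2 := translate_eq_of_two_vertices hp hp' he0 (z - e • (p' - p))
  have e1 : z - e • (p' - p) + (t + e) • (p' - p) = z + t • (p' - p) := by rw [add_smul]; abel
  have e2 : z - e • (p' - p) + e • (p' - p) = z := by abel
  rw [e1] at h1
  rw [e2] at h2
  rw [h1, ← h2]

/-- **The invariance directions form a subspace**: if `f` is invariant under every translation along each `w ∈ S`, then along every `w ∈ span_K S`.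
[folklore] -/
theorem translate_invariant_of_mem_span {f : (σ → K) → K} {S : Set (σ → K)}
    (hS : ∀ w ∈ S, ∀ (t : K) (z : σ → K), f (z + t • w) = f z)
    {w : σ → K} (hw : w ∈ Submodule.span K S) (t : K) (z : σ → K) : f (z + t • w) = f z := by
  induction hw using Submodule.span_induction generalizing t z with
  | mem w hw => exact hS w hw t z
  | zero => simp
  | add w₁ w₂ _ _ h₁ h₂ =>
    rw [smul_add, ← add_assoc, h₂, h₁]
  | smul a w _ h =>
    rw [smul_smul]
    exact h (t * a) z

end Summit.ResolutionOfSingularities.ResolutionOfSingularities.Theorems.SwitchingDichotomy.NonRationalWindow.BiConeForms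

end
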